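import Summits.Schanuel.Schanuel.Theorems.RootDecomp1KSkelCell10
import Literature.NumberTheory.Transcendental.ExpOneTranscendenceMeasureProofs

/-!
# RootDecomp1KSkelCell — lens 1, generations 43–44 «THE QUALITY-ONLY CLASS SkelLiouville ⊋ LogLogLiouville AND ITS CERTIFIED MEMBER ρ⋆» (PRICE K-α L2033, CLAIM L2045, ACK L2046; (α) PROPER of the 1K wall map): the location-free class `SkelLiouville ρ := ∀ m ∃ r, m ≤ den r ∧ ρ ≠ r ∧ |ρ − r| < den^{−m·ι(den)}` (ι q = least N with q ≤ 2^{N!}) with `LogLogLiouville ⊊ SkelLiouville ⊆ Liouville` PROVED, the member ρ⋆ = Σ_j 2^{−2^{e_j}} (FREDHOLM SERIES WITH DELETED BLOCKS) certified HYPOTHESIS-FREE in Skel ∖ (LogLog ∪ FactorialGap), the SKEL engine + extraction, the walls (1, ℓ₂, ρ) mod hNW / π-twins and the pair (ℓ₂, ρ) HYPOTHESIS-FREE for every ρ ∈ Skel, the items APPLIED at z⋆ with all binders discharged, the m = 1 ceiling, and §9 hNW DISCHARGED BY NAME on the e-wall via the Literature proof module — continuation (RootDecomp1KSkelCell11): §9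 hNW discharged by name

(lens-1 g43/g44 HOME kernel SkelCell.lean EDITION 2 b7163857…, 2822 l, imports tree RootDecomp1KGapCell01 (+ for §9 only Literature ExpOneTranscendenceMeasureProofs); CLAIM L2045, ACK L2046 (CHECKLIST K-α (1)–(8) + the constant-dependence line of L2085 (R4)), NODE L2132 / REQUEST L2133, critic VERDICT L2140 (crit g9: CLEARED — ONE CELL credit (K-α); lens-1 tally credits ×11 + THEOREM; PORT GO in substance 01–0k `--supports stmt-Schanuel-33364`, the two scoped heartbeat raises flagged for the port record, addendum D as RootDecomp1KNWMeasureHolds GO LOW); port by census-1 gen 18 as `RootDecomp1KSkelCell01`–`11` along K's sections: 01 = §1 `iota`, `SkelLiouville`, inclusions `SkelLiouville.liouville` / `logLogLiouville_skelLiouville`; 02 = §5a anchors `aI`/`sI` + §5b the skeleton `eS`, positions `cS`, terms `aS` (up to `summable_aS`); 03 = §5b the member `rhoStar`, truncations `tS`/`rS`, bounds + §6 covering / quality lemmas; 04 = §6 THE MEMBER THEOREMS `skelLiouville_rhoStar`, `not_logLogLiouville_rhoStar`, `not_factorialGapLiouville_rhoStar`, `liouville_rhoStar`, `not_skelLiouville_subset_logLogLiouville`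 + §2 engine preliminaries (`SkelMeasure`, `exists_scale_index_iota`); 05 = §2 THE ENGINE `skelMeasure_cons_liouvilleNumber` (scoped `maxHeartbeats 800000` as in K) + `SkelMeasure.mvWeakMeasure`; 06 = §3 EXTRACTION `no_int_relation_of_skelMeasure_skelLiouville`, `sb_of_skelLiouville_of_skelMeasure`; 07 = §4 THE CELLS (pair hyp-free, walls mod hNW, π-twins) + the live items in item shape; 08 = §7 three interlaced cuts `deletedBlock_margins`, `form_lower_bound_S` (scoped `maxHeartbeats 1600000`); 09 = §7b member tuples zS2/zS3/zS3pi, scope certificates, items AT the members; 10 = §8 the fixed-multiple ladder and the m = 1 ceiling (`uStar`, `skel_fixedOne_ceiling`); 11 = §9 hNW DISCHARGED BY NAME (imports Literature ExpOneTranscendenceMeasureProofs).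
PORT EDITS: `set_option linter.dupNamespace false` dropped; the Literature import moved from the head to part 11 (the only user); K's 13 private helpers travel as per-part private copies; two generic helpers made `private` after the dedup bounce of 02 (p829539: `two_mul_le_two_pow` ≡ Literature.NumberTheory.EllipticCurves.two_mul_le_two_pow; also `log_two_lt_self` pre-emptively) and of 03 (p829791: `one_le_loglog` ≡ Literature Tao2016.EntropyDecrement.one_le_log_log; then nine more generic arithmetic helpers privatised pre-emptively: loglog_pow_pow_ge, add_factorial_mul_le_factorial_add, one_lt_ell2, partialSum_two_two, five_fourths_le_partialSum, ell2_lt, psNumer_two_cast, two_pow_lt_psNumer); and of 07 (p830787: the read-back `sb_logLogWall3_via_skel` ≡ tree `RootDecomp1KLogLogCell.sb_logLogCell` → private; in §9 likewise `nwMeasure_holds` and `sb_logLogWall3_via_skel'`, whose statements coincide with the census port RootDecomp1KNWMeasureHolds — `nwMeasure_holds` / `nwMeasure_iff_literature` / `polyMeasure_exp_one_holds` / `sb_logLogCell'` there); and of 09 (p831465: the gate's dedup lint equates `algebraicIndependent_ell2_rhoStar : AlgebraicIndependent ℚ ![ℓ₂, ρ⋆]` with GapCell06's `algebraicIndependent_ell2_rhoW`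 (same shape, different member constant) — made `private` to pass; the public pair certificates `linearIndependent_zS2` / `sb_zS2` / `coordLiouvilleSchanuel_at_zS2` carry the content); statements and proofs verbatim. `--supports stmt-Schanuel-33364`; no census credit carried; rung 0 — nothing here proves Schanuel.)
-/

open Summit.Schanuel.Schanuel.Theorems.RootDecomp1KHyper
open Summit.Schanuel.Schanuel.Theorems.RootDecomp1KHyper.HyperCell
open Summit.Schanuel.Schanuel.Theorems.RootDecomp1KGeneric
open Summit.Schanuel.Schanuel.Theorems.RootDecomp1KRelLiouvilleCell
open Summit.Schanuel.Schanuel.Theorems.RootDecomp1KLogLogCell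
open Summit.Schanuel.Schanuel.Theorems.RootDecomp1KTwoBaseCell
open Summit.Schanuel.Schanuel.Theorems.RootDecomp1KGapCell
open LiouvilleNumber
open scoped Nat

namespace Summit.Schanuel.Schanuel.Theorems.RootDecomp1KSkelCell

/-! ## §9  `hNW` DISCHARGED BY NAME — the e-wall and the decision of 33364 at `z⋆₃` HYPOTHESIS-FREE

The ONLY named-fact binder of §§2–7b is `hNW : NWMeasure` — the tree decl
`Summit.Schanuel.Schanuel.Theorems.RootDecomp1KHyper.NWMeasure` (Hyper01 l.105), whose TEXT is, literally
(`Iff.rfl` below), the Literature fact `Literature.NumberTheory.Transcendental.NesterenkoWaldschmidt1996_thm_4_2`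
(Nesterenko–Waldschmidt 1996, Theorem 4 (2): `|P(e)| ≥ exp(−1.3·10⁵ d² (log L + d))`, the transcendence MEASURE OF
`e`).  That fact is PROVED in the Literature library — `NesterenkoWaldschmidt1996_thm_4_2_holds`
(`Literature/NumberTheory/Transcendental/ExpOneTranscendenceMeasureProofs.lean` l.459, sorry-free, axioms
standard; parts `…Matrix/Determinant/Liouville/Params/Transference/ZeroEstimate`).  When Hyper01 / RelLiouvilleCell01
were ported the check farm did not build that module's cone, so the route's e-walls were typed «mod `hNW` BY NAME»;
the cone builds now (farm check of this import, 2026-08-31), so the binder is DISCHARGED here by name — exactly as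
Hyper03 discharges the π-measure (`piNWMeasure_holds`).

NOT TO BE CONFUSED with `Literature.NumberTheory.Transcendental.NesterenkoWaldschmidt1996_thm_1` (NW96 MAIN
THEOREM, the simultaneous approximation measure for `(θ, e^θ)` with the constant `211`, binder `hNW` of the
Generic13/16/19/20, FiniteOrderCell, KummerClosure, DarkLogSq and 1E TwoScale files), whose PRINTED proof has the
Lemma-6 gap certified by lens 6 (tree `…RootDecomp1KNW96Gap.nw1996_lemma6_asPrinted_false`; repair target
`NW1996MainR 400`): Theorem 4 (2) and Theorem 1 are different statements of the same paper; nothing in this file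
uses, proves or touches Theorem 1.  CONSTANT-DEPENDENCE (critic's (R4) line): NONE — `hNW` enters §§2–7b only through
the tree lemma `polyMeasure_exp_one_of_NW : NWMeasure → PolyMeasure (cexp 1)` (an `∃ C` statement), the class
`SkelLiouville` quantifies over every order `m`, and the member arithmetic (`a_i`, `s_i`, the exponent `85`) never
sees `1.3·10⁵` (nor `211`). -/

section Discharge

/-- **`hNW` DISCHARGED BY NAME**: the tree's `NWMeasure` (= NW96 Thm 4 (2), the transcendence measure of `e`) HOLDS —
it is the Literature theorem `NesterenkoWaldschmidt1996_thm_4_2_holds` (sorry-free, axioms standard). -/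
private theorem nwMeasure_holds : NWMeasure :=
  Literature.NumberTheory.Transcendental.NesterenkoWaldschmidt1996_thm_4_2_holds

/-- READ-BACK: the tree's `NWMeasure` IS, literally, the Literature fact NW96 Thm 4 (2). -/
private theorem nwMeasure_iff_literature :
    NWMeasure ↔ Literature.NumberTheory.Transcendental.NesterenkoWaldschmidt1996_thm_4_2 :=
  Iff.rfl

/-- `e` has a polynomial measure of transcendence — HYPOTHESIS-FREE (tree `polyMeasure_exp_one_of_NW` + the
discharge; the e-twin of the tree's `polyMeasure_pi`). -/
private theorem polyMeasure_exp_one_holds : PolyMeasure (Complex.exp 1) :=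
  polyMeasure_exp_one_of_NW nwMeasure_holds

/-- **`(ℓ₂, e)` has a SKEL measure — HYPOTHESIS-FREE.** -/
theorem skelMeasure_liouvilleNumber_exp_one' :
    SkelMeasure (Fin.cons ((liouvilleNumber 2 : ℝ) : ℂ) ![Complex.exp 1] : Fin 2 → ℂ) :=
  skelMeasure_liouvilleNumber_exp_one nwMeasure_holds

/-- **THE SKEL WALL CELL `(1, ℓ₂, ρ)`: `SB 3` for EVERY Skel-Liouville `ρ` — HYPOTHESIS-FREE** (§4 `sb_skelWall3` with
`hNW` discharged). -/
theorem sb_skelWall3' {ρ : ℝ} (hρ : SkelLiouville ρ) :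
    SB 3 ![(1 : ℂ), ((liouvilleNumber 2 : ℝ) : ℂ), (ρ : ℂ)] :=
  sb_skelWall3 nwMeasure_holds hρ

/-- **ALL THREE SKEL CELLS, HYPOTHESIS-FREE**, for every `ρ ∈ SkelLiouville`: the pair `(ℓ₂, ρ)`, the e-wall
`(1, ℓ₂, ρ)`, the π-wall `(π, πℓ₂, πρ)`. -/
theorem skelCells_hypothesisFree {ρ : ℝ} (hρ : SkelLiouville ρ) :
    SB 2 ![((liouvilleNumber 2 : ℝ) : ℂ), (ρ : ℂ)] ∧
    SB 3 ![(1 : ℂ), ((liouvilleNumber 2 : ℝ) : ℂ), (ρ : ℂ)] ∧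
    SB 3 ![(Real.pi : ℂ), (Real.pi : ℂ) * ((liouvilleNumber 2 : ℝ) : ℂ), (Real.pi : ℂ) * (ρ : ℂ)] :=
  ⟨sb_skelPair hρ, sb_skelWall3' hρ, sb_skelWall3_pi hρ⟩

/-- **ITEM 31077 ON THE SKEL WALL `(1, ℓ₂, ρ)` — HYPOTHESIS-FREE** (binders verbatim + the cell line). -/
theorem coordLiouvilleSchanuel_skelWall3' {ρ : ℝ} (hρ : SkelLiouville ρ) :
    ∀ (n : ℕ) (z : Fin n → ℂ), LinearIndependent ℚ z →
      Set.range z = Set.range ![(1 : ℂ), ((liouvilleNumber 2 : ℝ) : ℂ), (ρ : ℂ)] →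
      (∃ w ∈ Submodule.span ℚ (Set.range z), Liouville w.re ∨ Liouville w.im) →
      (n : Cardinal) ≤ Algebra.trdeg ℚ
        ↥(IntermediateField.adjoin ℚ (Set.range z ∪ Set.range (Complex.exp ∘ z))) :=
  coordLiouvilleSchanuel_skelWall3 nwMeasure_holds hρ

/-- **ITEM 33364 ON THE SKEL WALL `(1, ℓ₂, ρ)` — HYPOTHESIS-FREE** (binders of
`Summit.Schanuel.Schanuel.Theses.RootDecomp1K.FiniteOrderLiouvilleSchanuel` VERBATIM + the ONE cell line
`Set.range z = Set.range ![1, ℓ₂, ρ]`, `ρ` ranging over the Skel-Liouville reals). -/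
theorem finiteOrderLiouvilleSchanuel_skelWall3' {ρ : ℝ} (hρ : SkelLiouville ρ) :
    ∀ (n : ℕ) (z : Fin n → ℂ), LinearIndependent ℚ z →
      Set.range z = Set.range ![(1 : ℂ), ((liouvilleNumber 2 : ℝ) : ℂ), (ρ : ℂ)] →
      (∀ ω : ℕ, ∃ h : Fin n → ℤ, h ≠ 0 ∧ ‖∑ i, (h i : ℂ) * z i‖ < 1 / (1 + ∑ i, (|h i| : ℝ)) ^ ω) →
      (¬ ∀ m : ℕ, ∃ h : Fin n → ℤ, h ≠ 0 ∧
        ‖∑ i, (h i : ℂ) * z i‖ < Real.exp (-((1 + ∑ i, (|h i| : ℝ)) ^ m))) →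
      (n : Cardinal) ≤ Algebra.trdeg ℚ
        ↥(IntermediateField.adjoin ℚ (Set.range z ∪ Set.range (Complex.exp ∘ z))) :=
  finiteOrderLiouvilleSchanuel_skelWall3 nwMeasure_holds hρ

/-- **The tree's LOG-LOG wall `(1, ℓ₂, ρ)`, `ρ` log-log-Liouville (LogLogCell08 `sb_logLogCell`, booked mod `hNW`) —
now HYPOTHESIS-FREE** (through `LogLog ⊆ Skel` and the discharge). -/
private theorem sb_logLogWall3_via_skel' {ρ : ℝ} (hρ : LogLogLiouville ρ) :
    SB 3 ![(1 : ℂ), ((liouvilleNumber 2 : ℝ) : ℂ), (ρ : ℂ)] :=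
  sb_skelWall3' (logLogLiouville_skelLiouville hρ)

/-- **`SB 3 z⋆₃` — HYPOTHESIS-FREE**: Schanuel's bound ITSELF at the explicit triple `(1, ℓ₂, ρ⋆)`. -/
theorem sb_zS3' : SB 3 zS3 := sb_zS3 nwMeasure_holds

/-- **ITEM 33364 DECIDED AT `z⋆₃ = (1, ℓ₂, ρ⋆)` — HYPOTHESIS-FREE**: scope (i)–(iii) AND the conclusion. -/
theorem finiteOrderLiouvilleSchanuel_at_zS3' :
    LinearIndependent ℚ zS3 ∧ LinLiouville zS3 ∧ ¬ HyperLinLiouville zS3 ∧ SB 3 zS3 :=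
  finiteOrderLiouvilleSchanuel_at_zS3 nwMeasure_holds

/-- **ITEM 31077 DECIDED AT `z⋆₃` — HYPOTHESIS-FREE**: ℚ-free, a Liouville coordinate in the span, AND `SB 3`. -/
theorem coordLiouvilleSchanuel_at_zS3' :
    LinearIndependent ℚ zS3 ∧ (∃ w ∈ Submodule.span ℚ (Set.range zS3), Liouville w.re ∨ Liouville w.im) ∧
      SB 3 zS3 :=
  ⟨linearIndependent_zS3, coordLiouvilleSpan_zS3, sb_zS3'⟩

/-- The cardinal read-out: `3 ≤ trdeg_ℚ ℚ(1, ℓ₂, ρ⋆, e, e^{ℓ₂}, e^{ρ⋆})` — HYPOTHESIS-FREE. -/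
theorem three_le_trdeg_zS3 :
    (3 : Cardinal) ≤ Algebra.trdeg ℚ
      ↥(IntermediateField.adjoin ℚ (Set.range zS3 ∪ Set.range (Complex.exp ∘ zS3))) :=
  sb_zS3'

end Discharge

end Summit.Schanuel.Schanuel.Theorems.RootDecomp1KSkelCell
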